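import Summits.QuantumFields.BalabanUV.T4Continuum.Spine.NE1p.DressedSmallFieldOnCoresSlotLettersHerm
import Summits.QuantumFields.BalabanUV.T4Continuum.Spine.NE1p.DressedSmallFieldOnCoresSlotLettersMassTorus

/-!
# T⁴ programme, spine estimate NE1′ (node O3b/H2) — S35 ON THE TORUS OF THE PAPERS: the slot ENDs at the core letters of record for a
# HERMITIAN centre reading ((B3) in row NE5's `factorMass` currency, centre conditions = entry bound + Hermitian symmetry + γ-coercivity)
# at pv22's `tgeometry 4 N` — NO geometry hypothesis —, the ϱ-FREE sharp-room-3 form, the HERM ∘ TORUS commuting square in kernel, and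
# the LOCATED TIGHTNESS of S32's floor relettering (equality at `m⋆ = mq`)

Cell `pub-balaban`, sub-cell `t4`, BINDER-OWNERS row NE1′ (owner lineage t4-ne1p-p1); crew seat `b2b-balaban-t4-ne1p-formalise-leaf-04`
(LEAF PROVER 04, generation 14); crew FACE row (INTENT `CLAIMS.log` 2026-08-20; the sibling of this lineage's S31 and «S32 ON THE TORUS»).
ADDITIVE — imports crew rows S35 `Spine/NE1p/DressedSmallFieldOnCoresSlotLettersHerm` (leaf-01; ⇒ S32 `DressedSmallFieldOnCoresSlotLettersMass`
⇒ S30 ⇒ the owner's N0r ⇒ N0q ⇒ N0p ⇒ N0o ⇒ N0m; ⇒ row NE5's `Support/B13TermCoreMass`; ⇒ the substrate cell's `Support/SubstrateSlotsOfRecord`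
∕ `SubstrateGaussianLettersBall` ∕ `SubstrateActivities`; Mathlib's `Matrix.IsHermitian` spectral theorem) and this lineage's
`Spine/NE1p/DressedSmallFieldOnCoresSlotLettersMassTorus` («S32 ON THE TORUS»; ⇒ S31 ⇒ S29 ⇒ S24, pv22's `TreeLengthTorusGeometry`) ONLY;
THEOREMS ONLY (+ one `example`; 0 `def`, 0 `def … : Prop`, 0 cite); nothing of S30 ∕ S31 ∕ S32 ∕ S35 ∕ N0m–N0r ∕ S24–S29 ∕ the substrate ∕ row
NE5 restated — their declarations are used BY NAME.

WHY THIS FILE.  S35 reduces S30's four displayed CENTRE CONDITIONS to the entry bound `hent`, the Hermitian symmetry `hherm` and the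
γ-coercivity `hco` of the centre reading (the two determinant clauses and the letter `d₀ := γ^{card}` are KERNEL consequences of the
spectral theorem), on S32's `factorMass` currency — but over a GENERAL `Ge : B13Resummation.Geometry 𝔇 Cube` with N0m §2's radius
binders `hϱ` ∕ `hϱA`.  «S32 ON THE TORUS» put S32's ENDs on pv22's CONSTRUCTED torus geometry.  THIS FILE wires both at once — the S24–S34 torus
pattern verbatim, nothing else — and records one located arithmetic fact about S32's relettering:
* §1 at `𝔇 := tsys 4 N`, `Ge := tgeometry 4 N` (pv22), constants LOCATED AS NUMERALS by N0o `torus_consts` + S24 `K₀_four` BY NAME (ν = 9,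
  κ₀ = 64·log 162, c₁ = 64, K₀ = `B12TreeDecay.K₀ 64 8`; print's (2.27) `c = 5` through `b₅ := 5·r₁`):
  `attachedPart_locE_le_of_coreLettersOf_herm_torus` ∕ `muPart_locE_le_of_coreLettersOf_herm_torus` (S35 §2 ONCE BY NAME each).
* §2 `attachedPart_locE_le_of_coreLettersOf_herm_printClause_three_torus` — the ϱ-FREE form (through §1 at the pencil radius
  `ϱ⋆ := max 2 (A₀/A₁)`, `hϱ` ∕ `hϱA` ∕ `hsmall` SUPPLIED by N0m §4∕§4b's `two_le_pencilRadius` ∕ `intercept_le_pencilRadius_mul` ∕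
  `pencilClause_of_printClause_three` BY NAME under a live slope `0 < A₁ ≤ A₀` and `h3 : 3·A₀·(e^{5r₁+1}·K₀(64,8)·9·64) ≤ 1` — NO radius
  binder; `hH` and `hF3`'s growth radius READ AT `ϱ⋆`).
* §3 one `example` — THE HERM ∘ TORUS COMMUTING SQUARE IN KERNEL: §1's `attachedPart_locE_le_of_coreLettersOf_herm_torus` IS «S32 ON THE
  TORUS» §1's `attachedPart_locE_le_of_coreLettersOf_factorMass_torus` at `d₀ := γ^{card}` with `hd₀` PROVED by S35's `coercivity_letter_pos` and
  `hctr` PRODUCED by S35's `hctr_of_hermitian` BY NAME — S35 §2's own proof transplanted to the torus (torus-then-Herm = Herm-then-torus); NO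
  new inequality.
* §4 `letterMass_eq_factorMass_at_floor` — LOCATED TIGHTNESS of S32 §1 (`letterMass_le_factorMass`): AT the floor `mq = m⋆` the S30 letter
  summand `λ(univ)·(wB·N₀·e⁰)·(π/(m⋆/2))^{dim/2}·e^{N₁R₀}` EQUALS row NE5's `factorMass 𝔠 N₀f 0 m⋆ R₀ Z j` — the relettering loses NOTHING
  at the floor and exactly the factor `(mq/m⋆)^{dim/2}` above it (pure real arithmetic, `unfold factorMass`; X143's INFO recorded in kernel).
Conclusions LITERALLY the crew's ONE torus currency: attached parts `≤ 4·(e·9·64·K₀(64,8)²)·A₁·e^{−r₁·torusTreeLen X₀}`, μ-parts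
`≤ e·9·64·K₀(64,8)²·A′·e^{−r₁·torusTreeLen X₀}·μ₀/(μ₁ − μ₀)`.
CENSUS vs S35 §2 (binders): MINUS = [`𝔇`, `Cube`, `Ge`, `b₅`, `hb`] (ϱ-free form: also [`ϱ`, `hϱ`, `hϱA`, `hsmall`] ↦ [`hA₁ : 0 < A₁`,
`hle`, `h3`]); PLUS = [`N`, `[NeZero N]`]; `hF3` reads `Z.1 ⊆ X₀.1` ∕ `torusTreeLen Z.1` for `Ge.cubes Z ⊆ Ge.cubes X₀` ∕ `𝔇.dj Z`; rest
IDENTICAL.  CENSUS vs «S32 ON THE TORUS» §1 (the square): MINUS = [`d₀`, `hd₀`, `hctr`]; PLUS = [`hent`, `hherm`, `hco`]; `hbud` ∕ `hF3`'s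
`N₀f` read at `d₀ := γ^{card}`.
WHAT STAYS DISPLAYED (binders, by name; NOTHING instantiated on Bałaban's densities): `hroom`, `0 ≤ R′ k`; per factor the substrate's
primitive letter conditions, the REDUCED centre conditions `hent` ∕ `hherm` ∕ `hco` (whose identification with Bałaban's quadratic forms is the
substrate's ∕ S35's READING, not asserted) and the determinant budget `hbud` at `γ^{card}`; the margin FLOOR `0 < m⋆ ≤ (γ − card·ϑ·R′ k)/2`;
`hO` ∕ `hH`; (B1b)'s residue `terms` ∕ `emb` ∕ `hscale`; (B3) = `hF3` on row NE5's `factorMass` letters of the cores of record — G-ne9p2-5,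
UNPRINTED, shared with NE9 ∕ NE5, a BINDER, never `[cite:`-tagged; the located clauses «κ large» `r₁ + 2·(64·log 162) + 2 ≤ R` and «ε₁
small» in the SHAPES `(A₀ + ϱA₁)·E ≤ 1` ∕ `3·A₀·E ≤ 1` ∕ `A′·E ≤ 1`, `E = e^{5r₁+1}·K₀(64,8)·9·64` ((B5): the SHAPES and the factor `3` are
the owner's arithmetic consumed BY NAME; their standing against print's NUMBERS is untouched).  (B4) is discharged BY NAME on pv22's
CONSTRUCTED torus geometry (pv22's READING of 𝐃_{k+1} ∕ d_{k+1}, DIVERGENCE D-pv22.3, not asserted here); no wall item moves; the wall line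
v1.7 (T4-DAG v43) does NOT move; R-t4r2-Q2 NOT met thereby.
HONEST FRAMING.  Kernel bookkeeping — by-name composition of S35 (Hermitian centre reading) with the S24–S34 torus pattern, one consistency
square and one line of real arithmetic; cores ∕ letters ∕ `actOfLetters` ∕ `coreLettersOf` ∕ `factorMass` ∕ `linForm` are the cell's typed
FORMAT of (2.14) and row NE5's typed mass letter, NOT Bałaban's functions; printed loci ([Balaban1988RGII] (2.14) p. 15, (2.18) p. 16, (1.26)
p. 8, (2.27) ∕ (2.30) p. 18, (2.38) p. 20; [Balaban1987RGI] p. 251, p. 257) are TYPE ∕ CONTEXT through the imported [cite]-tagged Literature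
modules, re-asserted nowhere; ABSOLUTE RULE honoured ([folklore] kernel lemmas only); no numeral of print.  NE1′ ⇐ the named binders — NOT
printed, NOT proved; 0 leaves instantiated on Bałaban's densities; spine PROVED 0∕9; count 9 unchanged.  Rung (B)+1 on ONE finite
four-torus — NOT infinite volume, NOT a mass gap, NOT OS on ℝ⁴, NOT Clay.  HONEST DEPENDENCY: continuum YM on T⁴ ⇐ BetaPertH ∧ nine spine
estimates (0/9 proved); BetaPertH ⇐ (D1) ∧ (D4) ∧ CAP+tail; G-an2-4 gates asym, D1 and NE2/3/4.
-/

noncomputable section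

namespace Summit.QuantumFields.BalabanUV.T4Continuum.NE1p.DressedSmallFieldOnCoresSlotLettersHermTorus

open scoped BigOperators Matrix
open Metric Set MeasureTheory
open Literature.MathematicalPhysics.QuantumFieldTheory.Balaban1983to89
open Literature.MathematicalPhysics.QuantumFieldTheory.Balaban1983to89.B13Resummation (locE)
open Literature.MathematicalPhysics.QuantumFieldTheory.Balaban1983to89.B5Prop11Lower (nsq)
open Literature.MathematicalPhysics.QuantumFieldTheory.Balaban1983to89.TreeLengthTorus (tsys torusTreeLen)
open Literature.MathematicalPhysics.QuantumFieldTheory.Balaban1983to89.TreeLengthTorusGeometry (TTouch tgeometry)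
open Literature.MathematicalPhysics.QuantumFieldTheory.Balaban1983to89.B12TreeDecay (K₀ K₀_pos)
open Literature.MathematicalPhysics.QuantumFieldTheory.Balaban1983to89.T4OutputRate (Carriers)
open Summit.QuantumFields.BalabanUV.T4Continuum.B13HistMeasurable (MeasPotFrame B13HistM)
open Summit.QuantumFields.BalabanUV.T4Continuum.B13TermParamGaussianBi (BiCore)
open Summit.QuantumFields.BalabanUV.T4Continuum.B13TermCoreMass (factorMass)
open Summit.QuantumFields.BalabanUV.T4Continuum.SubstrateTwoRunsDriven (DrivenRuns)
open Summit.QuantumFields.BalabanUV.T4Continuum.SubstrateActivities (coreOf actOfLetters)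
open Summit.QuantumFields.BalabanUV.T4Continuum.SubstrateGaussianLetters (gaussC gaussC_pos linForm)
open Summit.QuantumFields.BalabanUV.T4Continuum.SubstrateGaussianLettersBall (detBudget)
open Summit.QuantumFields.BalabanUV.T4Continuum.SubstrateSlotsOfRecord (ActLetters coreLettersOf)
open Summit.QuantumFields.BalabanUV.T4Continuum.NE1p.DressedSmallFieldOnCoresSlotLettersHerm (coercivity_letter_pos hctr_of_hermitian
  attachedPart_locE_le_of_coreLettersOf_herm muPart_locE_le_of_coreLettersOf_herm)
open Summit.QuantumFields.BalabanUV.T4Continuum.NE1p.DressedSmallFieldOnCoresSlotLettersMassTorus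
  (attachedPart_locE_le_of_coreLettersOf_factorMass_torus)
open Summit.QuantumFields.BalabanUV.T4Continuum.NE1p.DressedSmallFieldInduction (two_le_pencilRadius intercept_le_pencilRadius_mul
  pencilClause_of_printClause_three)
open Summit.QuantumFields.BalabanUV.T4Continuum.NE1p.DressedSmallFieldGeometry (torus_consts)
open Summit.QuantumFields.BalabanUV.T4Continuum.NE1p.DressedSmallFieldGeometryFaces (K₀_four)

/- ELABORATION NOTE (instance hygiene, no mathematics; R-T123 (vii)).  As in S31 ∕ «S32 ON THE TORUS»: the substrate's `Support/B13Carriers` —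
in the cone through S30 — registers the global instance `TwoRuns.instDecidableEqTDom`; every conclusion below therefore pins
`locE (Dom := (tsys 4 N).Dom) …` so that instance search stays classical and the statements PRINT exactly as S29's ∕ S31's, closed by
S35's ∕ this lineage's ENDs BY NAME with no cast. -/

variable {G : Type} [GaugeGroup G] (D : DrivenRuns G) (P : MeasPotFrame D.carriers) {N : ℕ} [NeZero N]

variable (Op : Type) [NormedAddCommGroup Op] [NormedSpace ℂ Op] {J : Type}
  (𝒵 : D.carriers.Dom → J → Type) [∀ Z j, Fintype (𝒵 Z j)] (dom : ∀ Z j, 𝒵 Z j → D.carriers.Dom)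
  (Jc : D.carriers.Dom → J → Type) [∀ Z j, Fintype (Jc Z j)]
  (V : D.carriers.Dom → J → Type) [∀ Z j, NormedAddCommGroup (V Z j)] [∀ Z j, InnerProductSpace ℝ (V Z j)]
  [∀ Z j, MeasurableSpace (V Z j)] [∀ Z j, BorelSpace (V Z j)] [∀ Z j, FiniteDimensional ℝ (V Z j)]
  (mI : D.carriers.Dom → J → Type) [∀ Z j, Fintype (mI Z j)] [∀ Z j, DecidableEq (mI Z j)]

/-! ## §1 S35 §2's two ENDs ON THE TORUS `tgeometry 4 N` — Hermitian centre reading, no geometry hypothesis -/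

open Classical in
/-- **THE ATTACHED PART OF THE SLOT ACTIVITIES AT THE CORE LETTERS OF RECORD, HERMITIAN CENTRE, ON THE TORUS** (kernel; S35 §2
`attachedPart_locE_le_of_coreLettersOf_herm` ONCE BY NAME at `𝔇 := tsys 4 N`, `Ge := tgeometry 4 N`, `b₅ := 5·r₁`, constants located by N0o
`torus_consts` + S24 `K₀_four`): binders = S35's with the geometry GONE (room, `0 ≤ R′`, the substrate's primitive per-factor letter conditions,
the REDUCED centre conditions `hent` ∕ `hherm` ∕ `hco`, `hbud` at `γ^{card}`, the margin FLOOR, class radii, `terms` ∕ `emb` ∕ `hscale`, the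
LOCATED clauses, (B3) `hF3` on row NE5's `factorMass` letters with `Z.1 ⊆ X₀.1` and `torusTreeLen`, N0m's `hϱ` ∕ `hϱA`); bound
`≤ 4·(e·9·64·K₀(64,8)²)·A₁·e^{−r₁·torusTreeLen X₀}` = S31's. [folklore] -/
theorem attachedPart_locE_le_of_coreLettersOf_herm_torus {W : Set (ℕ → ℝ)}
    {ctr : ℕ → (ℕ → ℝ) → D.carriers.BgB → Op × B13HistM P}
    {ROp RHist R' : ℕ → ℝ} (A : ∀ Z j, ActLetters D P Op 𝒵 dom Jc V mI Z j) {β₀ ϑ γ : D.carriers.Dom → J → ℝ} {mstar : ℝ}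
    (hroom : ∀ k, ROp k < R' k) (hR' : ∀ k, 0 ≤ R' k) (hbase : ∀ Z j ii jj, Measurable fun a => (A Z j).base a ii jj)
    (hrdm : ∀ Z j ii jj (o' : Op), Measurable fun a => (A Z j).rd a ii jj o')
    (hβ₀ : ∀ Z j, 0 ≤ β₀ Z j) (hrd : ∀ Z j a ii jj, ‖(A Z j).rd a ii jj‖ ≤ ϑ Z j)
    (hent : ∀ k, ∀ g ∈ W, ∀ (U : D.carriers.BgB) (Z : D.carriers.Dom) (j : J) (a : (Jc Z j ⊕ 𝒵 Z j) → ℝ × ℝ) ii jj,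
      ‖linForm (A Z j).base (A Z j).rd (ctr k g U).1 a ii jj‖ ≤ β₀ Z j)
    (hherm : ∀ k, ∀ g ∈ W, ∀ (U : D.carriers.BgB) (Z : D.carriers.Dom) (j : J) (a : (Jc Z j ⊕ 𝒵 Z j) → ℝ × ℝ),
      (linForm (A Z j).base (A Z j).rd (ctr k g U).1 a).IsHermitian)
    (hco : ∀ k, ∀ g ∈ W, ∀ (U : D.carriers.BgB) (Z : D.carriers.Dom) (j : J) (a : (Jc Z j ⊕ 𝒵 Z j) → ℝ × ℝ) (x : mI Z j → ℂ),
      γ Z j * nsq x ≤ (star x ⬝ᵥ (linForm (A Z j).base (A Z j).rd (ctr k g U).1 a *ᵥ x)).re)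
    (hbud : ∀ k Z j, detBudget (Fintype.card (mI Z j)) (β₀ Z j) (ϑ Z j) (R' k) < γ Z j ^ Fintype.card (mI Z j))
    (hmstar : 0 < mstar) (hfloor : ∀ k Z j, mstar ≤ (γ Z j - Fintype.card (mI Z j) * ϑ Z j * R' k) / 2)
    {k : ℕ} {g : ℕ → ℝ} (hg : g ∈ W) {U : D.carriers.BgB} {o : Op} {h₀ w : B13HistM P} {ϱ : ℝ}
    (hO : ‖o - (ctr k g U).1‖ ≤ ROp k) (hH : ‖h₀ - (ctr k g U).2‖ + ϱ * ‖w‖ ≤ RHist k)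
    {emb : (tsys 4 N).Dom → D.carriers.Dom} (hscale : ∀ Z, D.carriers.scale (emb Z) = k)
    (terms : (tsys 4 N).Dom → Finset (D.carriers.Dom × J))
    {A₀ A₁ R r₁ : ℝ} (X₀ : (tsys 4 N).Dom) (hA₀ : 0 ≤ A₀) (hA₁ : 0 ≤ A₁) (hr₁ : 0 ≤ r₁)
    (hrate : r₁ + 2 * (64 * Real.log 162) + 2 ≤ R)
    (hsmall : (A₀ + ϱ * A₁) * Real.exp (5 * r₁ + 1) * K₀ 64 8 * 9 * 64 ≤ 1)
    (hF3 : ∀ Z : (tsys 4 N).Dom, Z.1 ⊆ X₀.1 →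
      ∑ p ∈ terms Z, factorMass (fun Z j => coreOf P Op 𝒵 dom Jc V (coreLettersOf D P Op 𝒵 dom Jc V mI A) Z j)
          (fun Z j => gaussC (mI Z j) * Real.sqrt (max 1 ((Fintype.card (mI Z j)).factorial * β₀ Z j ^ Fintype.card (mI Z j) +
            γ Z j ^ Fintype.card (mI Z j))))
          (fun _ _ => 0) mstar (‖h₀‖ + ϱ * ‖w‖) p.1 p.2 ≤ (A₀ + ϱ * A₁) * Real.exp (-(R * torusTreeLen Z.1)))
    (hϱ : 2 ≤ ϱ) (hϱA : A₀ ≤ ϱ * A₁) :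
    ‖locE (Dom := (tsys 4 N).Dom) (TTouch (d := 4) (N := N)) (fun Z : (tsys 4 N).Dom => Z.1) (fun Z => ∑ p ∈ terms Z,
          actOfLetters P Op 𝒵 dom Jc V (coreLettersOf D P Op 𝒵 dom Jc V mI A) p.1 p.2 o (h₀ + w)) X₀.1 -
        locE (Dom := (tsys 4 N).Dom) (TTouch (d := 4) (N := N)) (fun Z : (tsys 4 N).Dom => Z.1) (fun Z => ∑ p ∈ terms Z,
          actOfLetters P Op 𝒵 dom Jc V (coreLettersOf D P Op 𝒵 dom Jc V mI A) p.1 p.2 o h₀) X₀.1‖ ≤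
      4 * (Real.exp 1 * 9 * 64 * K₀ 64 8 ^ 2) * A₁ * Real.exp (-(r₁ * torusTreeLen X₀.1)) := by
  obtain ⟨hν, hκ, hc⟩ := torus_consts N
  have h := attachedPart_locE_le_of_coreLettersOf_herm D P Op 𝒵 dom Jc V mI (tsys 4 N) (tgeometry 4 N) A hroom hR' hbase hrdm hβ₀ hrd
    hent hherm hco hbud hmstar hfloor hg hO hH hscale terms (R := R) (b₅ := 5 * r₁) (X₀ := X₀) hA₀ hA₁ hr₁ (le_of_eq (by ring))
    (by rw [hκ]; exact hrate) (by rw [K₀_four, hν, hc]; exact hsmall) hF3 hϱ hϱA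
  rw [hν, hc, K₀_four] at h
  exact h

open Classical in
/-- **THE μ-PART OF THE SAME, HERMITIAN CENTRE, ON THE TORUS** (kernel; S35 §2 `muPart_locE_le_of_coreLettersOf_herm` ONCE BY NAME at
`tgeometry 4 N`): SOURCE pencil `h₀ + s • v`, `0 < μ₀ < μ₁`, `‖sμ‖ ≤ μ₀`, `hF3` at the history radius `‖h₀‖ + μ₁‖v‖` and budget `A′`, `hH` at
`μ₁`; bound = the crew's μ-part currency. [folklore] -/
theorem muPart_locE_le_of_coreLettersOf_herm_torus {W : Set (ℕ → ℝ)}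
    {ctr : ℕ → (ℕ → ℝ) → D.carriers.BgB → Op × B13HistM P}
    {ROp RHist R' : ℕ → ℝ} (A : ∀ Z j, ActLetters D P Op 𝒵 dom Jc V mI Z j) {β₀ ϑ γ : D.carriers.Dom → J → ℝ} {mstar : ℝ}
    (hroom : ∀ k, ROp k < R' k) (hR' : ∀ k, 0 ≤ R' k) (hbase : ∀ Z j ii jj, Measurable fun a => (A Z j).base a ii jj)
    (hrdm : ∀ Z j ii jj (o' : Op), Measurable fun a => (A Z j).rd a ii jj o')
    (hβ₀ : ∀ Z j, 0 ≤ β₀ Z j) (hrd : ∀ Z j a ii jj, ‖(A Z j).rd a ii jj‖ ≤ ϑ Z j)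
    (hent : ∀ k, ∀ g ∈ W, ∀ (U : D.carriers.BgB) (Z : D.carriers.Dom) (j : J) (a : (Jc Z j ⊕ 𝒵 Z j) → ℝ × ℝ) ii jj,
      ‖linForm (A Z j).base (A Z j).rd (ctr k g U).1 a ii jj‖ ≤ β₀ Z j)
    (hherm : ∀ k, ∀ g ∈ W, ∀ (U : D.carriers.BgB) (Z : D.carriers.Dom) (j : J) (a : (Jc Z j ⊕ 𝒵 Z j) → ℝ × ℝ),
      (linForm (A Z j).base (A Z j).rd (ctr k g U).1 a).IsHermitian)
    (hco : ∀ k, ∀ g ∈ W, ∀ (U : D.carriers.BgB) (Z : D.carriers.Dom) (j : J) (a : (Jc Z j ⊕ 𝒵 Z j) → ℝ × ℝ) (x : mI Z j → ℂ),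
      γ Z j * nsq x ≤ (star x ⬝ᵥ (linForm (A Z j).base (A Z j).rd (ctr k g U).1 a *ᵥ x)).re)
    (hbud : ∀ k Z j, detBudget (Fintype.card (mI Z j)) (β₀ Z j) (ϑ Z j) (R' k) < γ Z j ^ Fintype.card (mI Z j))
    (hmstar : 0 < mstar) (hfloor : ∀ k Z j, mstar ≤ (γ Z j - Fintype.card (mI Z j) * ϑ Z j * R' k) / 2)
    {k : ℕ} {g : ℕ → ℝ} (hg : g ∈ W) {U : D.carriers.BgB} {o : Op} {h₀ v : B13HistM P} {μ₁ : ℝ}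
    (hO : ‖o - (ctr k g U).1‖ ≤ ROp k) (hH : ‖h₀ - (ctr k g U).2‖ + μ₁ * ‖v‖ ≤ RHist k)
    {emb : (tsys 4 N).Dom → D.carriers.Dom} (hscale : ∀ Z, D.carriers.scale (emb Z) = k)
    (terms : (tsys 4 N).Dom → Finset (D.carriers.Dom × J))
    {A' R r₁ μ₀ : ℝ} (X₀ : (tsys 4 N).Dom) {sμ : ℂ} (hA : 0 ≤ A') (hr₁ : 0 ≤ r₁)
    (hrate : r₁ + 2 * (64 * Real.log 162) + 2 ≤ R) (hsmall : A' * Real.exp (5 * r₁ + 1) * K₀ 64 8 * 9 * 64 ≤ 1)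
    (hF3 : ∀ Z : (tsys 4 N).Dom, Z.1 ⊆ X₀.1 →
      ∑ p ∈ terms Z, factorMass (fun Z j => coreOf P Op 𝒵 dom Jc V (coreLettersOf D P Op 𝒵 dom Jc V mI A) Z j)
          (fun Z j => gaussC (mI Z j) * Real.sqrt (max 1 ((Fintype.card (mI Z j)).factorial * β₀ Z j ^ Fintype.card (mI Z j) +
            γ Z j ^ Fintype.card (mI Z j))))
          (fun _ _ => 0) mstar (‖h₀‖ + μ₁ * ‖v‖) p.1 p.2 ≤ A' * Real.exp (-(R * torusTreeLen Z.1)))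
    (h0 : 0 < μ₀) (h01 : μ₀ < μ₁) (hμ : ‖sμ‖ ≤ μ₀) :
    ‖locE (Dom := (tsys 4 N).Dom) (TTouch (d := 4) (N := N)) (fun Z : (tsys 4 N).Dom => Z.1) (fun Z => ∑ p ∈ terms Z,
          actOfLetters P Op 𝒵 dom Jc V (coreLettersOf D P Op 𝒵 dom Jc V mI A) p.1 p.2 o (h₀ + sμ • v)) X₀.1 -
        locE (Dom := (tsys 4 N).Dom) (TTouch (d := 4) (N := N)) (fun Z : (tsys 4 N).Dom => Z.1) (fun Z => ∑ p ∈ terms Z,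
          actOfLetters P Op 𝒵 dom Jc V (coreLettersOf D P Op 𝒵 dom Jc V mI A) p.1 p.2 o h₀) X₀.1‖ ≤
      Real.exp 1 * 9 * 64 * K₀ 64 8 ^ 2 * A' * Real.exp (-(r₁ * torusTreeLen X₀.1)) * (μ₀ / (μ₁ - μ₀)) := by
  obtain ⟨hν, hκ, hc⟩ := torus_consts N
  have h := muPart_locE_le_of_coreLettersOf_herm D P Op 𝒵 dom Jc V mI (tsys 4 N) (tgeometry 4 N) A hroom hR' hbase hrdm hβ₀ hrd hent
    hherm hco hbud hmstar hfloor hg hO hH hscale terms (R := R) (b₅ := 5 * r₁) (X₀ := X₀) (sμ := sμ) hA hr₁ (le_of_eq (by ring))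
    (by rw [hκ]; exact hrate) (by rw [K₀_four, hν, hc]; exact hsmall) hF3 h0 h01 hμ
  rw [hν, hc, K₀_four] at h
  exact h

/-! ## §2 The ϱ-FREE form — no geometry hypothesis, no radius binder (N0m §4∕§4b's arithmetic BY NAME, sharp room 3) -/

open Classical in
/-- **THE SAME ATTACHED PART, ϱ-FREE, HERMITIAN CENTRE** (kernel; §1 `attachedPart_locE_le_of_coreLettersOf_herm_torus` at
`ϱ⋆ := max 2 (A₀/A₁)`, its `hϱ` ∕ `hϱA` ∕ `hsmall` SUPPLIED by N0m §4∕§4b's `two_le_pencilRadius` ∕ `intercept_le_pencilRadius_mul` ∕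
`pencilClause_of_printClause_three` BY NAME): live slope `0 < A₁ ≤ A₀`, «κ large», «ε₁ small with the sharp factor-3 room»
`3·A₀·(e^{5r₁+1}·K₀(64,8)·9·64) ≤ 1`, `hH` and `hF3`'s growth radius READ AT `ϱ⋆` ⇒ the same bound. [folklore] -/
theorem attachedPart_locE_le_of_coreLettersOf_herm_printClause_three_torus {W : Set (ℕ → ℝ)}
    {ctr : ℕ → (ℕ → ℝ) → D.carriers.BgB → Op × B13HistM P}
    {ROp RHist R' : ℕ → ℝ} (A : ∀ Z j, ActLetters D P Op 𝒵 dom Jc V mI Z j) {β₀ ϑ γ : D.carriers.Dom → J → ℝ} {mstar : ℝ}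
    (hroom : ∀ k, ROp k < R' k) (hR' : ∀ k, 0 ≤ R' k) (hbase : ∀ Z j ii jj, Measurable fun a => (A Z j).base a ii jj)
    (hrdm : ∀ Z j ii jj (o' : Op), Measurable fun a => (A Z j).rd a ii jj o')
    (hβ₀ : ∀ Z j, 0 ≤ β₀ Z j) (hrd : ∀ Z j a ii jj, ‖(A Z j).rd a ii jj‖ ≤ ϑ Z j)
    (hent : ∀ k, ∀ g ∈ W, ∀ (U : D.carriers.BgB) (Z : D.carriers.Dom) (j : J) (a : (Jc Z j ⊕ 𝒵 Z j) → ℝ × ℝ) ii jj,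
      ‖linForm (A Z j).base (A Z j).rd (ctr k g U).1 a ii jj‖ ≤ β₀ Z j)
    (hherm : ∀ k, ∀ g ∈ W, ∀ (U : D.carriers.BgB) (Z : D.carriers.Dom) (j : J) (a : (Jc Z j ⊕ 𝒵 Z j) → ℝ × ℝ),
      (linForm (A Z j).base (A Z j).rd (ctr k g U).1 a).IsHermitian)
    (hco : ∀ k, ∀ g ∈ W, ∀ (U : D.carriers.BgB) (Z : D.carriers.Dom) (j : J) (a : (Jc Z j ⊕ 𝒵 Z j) → ℝ × ℝ) (x : mI Z j → ℂ),
      γ Z j * nsq x ≤ (star x ⬝ᵥ (linForm (A Z j).base (A Z j).rd (ctr k g U).1 a *ᵥ x)).re)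
    (hbud : ∀ k Z j, detBudget (Fintype.card (mI Z j)) (β₀ Z j) (ϑ Z j) (R' k) < γ Z j ^ Fintype.card (mI Z j))
    (hmstar : 0 < mstar) (hfloor : ∀ k Z j, mstar ≤ (γ Z j - Fintype.card (mI Z j) * ϑ Z j * R' k) / 2)
    {k : ℕ} {g : ℕ → ℝ} (hg : g ∈ W) {U : D.carriers.BgB} {o : Op} {h₀ w : B13HistM P} {A₀ A₁ : ℝ}
    (hO : ‖o - (ctr k g U).1‖ ≤ ROp k) (hH : ‖h₀ - (ctr k g U).2‖ + max 2 (A₀ / A₁) * ‖w‖ ≤ RHist k)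
    {emb : (tsys 4 N).Dom → D.carriers.Dom} (hscale : ∀ Z, D.carriers.scale (emb Z) = k)
    (terms : (tsys 4 N).Dom → Finset (D.carriers.Dom × J))
    {R r₁ : ℝ} (X₀ : (tsys 4 N).Dom) (hA₀ : 0 ≤ A₀) (hA₁ : 0 < A₁) (hle : A₁ ≤ A₀) (hr₁ : 0 ≤ r₁)
    (hrate : r₁ + 2 * (64 * Real.log 162) + 2 ≤ R) (h3 : 3 * A₀ * (Real.exp (5 * r₁ + 1) * K₀ 64 8 * 9 * 64) ≤ 1)
    (hF3 : ∀ Z : (tsys 4 N).Dom, Z.1 ⊆ X₀.1 →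
      ∑ p ∈ terms Z, factorMass (fun Z j => coreOf P Op 𝒵 dom Jc V (coreLettersOf D P Op 𝒵 dom Jc V mI A) Z j)
          (fun Z j => gaussC (mI Z j) * Real.sqrt (max 1 ((Fintype.card (mI Z j)).factorial * β₀ Z j ^ Fintype.card (mI Z j) +
            γ Z j ^ Fintype.card (mI Z j))))
          (fun _ _ => 0) mstar (‖h₀‖ + max 2 (A₀ / A₁) * ‖w‖) p.1 p.2 ≤
        (A₀ + max 2 (A₀ / A₁) * A₁) * Real.exp (-(R * torusTreeLen Z.1))) :
    ‖locE (Dom := (tsys 4 N).Dom) (TTouch (d := 4) (N := N)) (fun Z : (tsys 4 N).Dom => Z.1) (fun Z => ∑ p ∈ terms Z,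
          actOfLetters P Op 𝒵 dom Jc V (coreLettersOf D P Op 𝒵 dom Jc V mI A) p.1 p.2 o (h₀ + w)) X₀.1 -
        locE (Dom := (tsys 4 N).Dom) (TTouch (d := 4) (N := N)) (fun Z : (tsys 4 N).Dom => Z.1) (fun Z => ∑ p ∈ terms Z,
          actOfLetters P Op 𝒵 dom Jc V (coreLettersOf D P Op 𝒵 dom Jc V mI A) p.1 p.2 o h₀) X₀.1‖ ≤
      4 * (Real.exp 1 * 9 * 64 * K₀ 64 8 ^ 2) * A₁ * Real.exp (-(r₁ * torusTreeLen X₀.1)) := by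
  have hE : 0 ≤ Real.exp (5 * r₁ + 1) * K₀ 64 8 * 9 * 64 :=
    mul_nonneg (mul_nonneg (mul_nonneg (Real.exp_nonneg _) (K₀_pos 64 8).le) (by norm_num)) (by norm_num)
  have hsmall : (A₀ + max 2 (A₀ / A₁) * A₁) * Real.exp (5 * r₁ + 1) * K₀ 64 8 * 9 * 64 ≤ 1 := by
    simpa only [mul_assoc] using pencilClause_of_printClause_three hA₁ hle hE h3
  exact attachedPart_locE_le_of_coreLettersOf_herm_torus D P Op 𝒵 dom Jc V mI A hroom hR' hbase hrdm hβ₀ hrd hent hherm hco hbud hmstar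
    hfloor hg hO hH hscale terms X₀ hA₀ hA₁.le hr₁ hrate hsmall hF3 (two_le_pencilRadius A₀ A₁) (intercept_le_pencilRadius_mul hA₁)

/-! ## §3 Consistency — THE HERM ∘ TORUS SQUARE COMMUTES, in kernel (torus-then-Herm = Herm-then-torus) -/

open Classical in
/-- (E) THE COMMUTING SQUARE: §1's `attachedPart_locE_le_of_coreLettersOf_herm_torus` IS «S32 ON THE TORUS» §1's
`attachedPart_locE_le_of_coreLettersOf_factorMass_torus` at `d₀ := γ^{card}` with `hd₀` PROVED by S35's `coercivity_letter_pos` and `hctr`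
PRODUCED by S35's `hctr_of_hermitian` BY NAME — S35 §2's own proof transplanted to the torus; NO new inequality. [folklore] -/
example {W : Set (ℕ → ℝ)}
    {ctr : ℕ → (ℕ → ℝ) → D.carriers.BgB → Op × B13HistM P}
    {ROp RHist R' : ℕ → ℝ} (A : ∀ Z j, ActLetters D P Op 𝒵 dom Jc V mI Z j) {β₀ ϑ γ : D.carriers.Dom → J → ℝ} {mstar : ℝ}
    (hroom : ∀ k, ROp k < R' k) (hR' : ∀ k, 0 ≤ R' k) (hbase : ∀ Z j ii jj, Measurable fun a => (A Z j).base a ii jj)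
    (hrdm : ∀ Z j ii jj (o' : Op), Measurable fun a => (A Z j).rd a ii jj o')
    (hβ₀ : ∀ Z j, 0 ≤ β₀ Z j) (hrd : ∀ Z j a ii jj, ‖(A Z j).rd a ii jj‖ ≤ ϑ Z j)
    (hent : ∀ k, ∀ g ∈ W, ∀ (U : D.carriers.BgB) (Z : D.carriers.Dom) (j : J) (a : (Jc Z j ⊕ 𝒵 Z j) → ℝ × ℝ) ii jj,
      ‖linForm (A Z j).base (A Z j).rd (ctr k g U).1 a ii jj‖ ≤ β₀ Z j)
    (hherm : ∀ k, ∀ g ∈ W, ∀ (U : D.carriers.BgB) (Z : D.carriers.Dom) (j : J) (a : (Jc Z j ⊕ 𝒵 Z j) → ℝ × ℝ),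
      (linForm (A Z j).base (A Z j).rd (ctr k g U).1 a).IsHermitian)
    (hco : ∀ k, ∀ g ∈ W, ∀ (U : D.carriers.BgB) (Z : D.carriers.Dom) (j : J) (a : (Jc Z j ⊕ 𝒵 Z j) → ℝ × ℝ) (x : mI Z j → ℂ),
      γ Z j * nsq x ≤ (star x ⬝ᵥ (linForm (A Z j).base (A Z j).rd (ctr k g U).1 a *ᵥ x)).re)
    (hbud : ∀ k Z j, detBudget (Fintype.card (mI Z j)) (β₀ Z j) (ϑ Z j) (R' k) < γ Z j ^ Fintype.card (mI Z j))
    (hmstar : 0 < mstar) (hfloor : ∀ k Z j, mstar ≤ (γ Z j - Fintype.card (mI Z j) * ϑ Z j * R' k) / 2)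
    {k : ℕ} {g : ℕ → ℝ} (hg : g ∈ W) {U : D.carriers.BgB} {o : Op} {h₀ w : B13HistM P} {ϱ : ℝ}
    (hO : ‖o - (ctr k g U).1‖ ≤ ROp k) (hH : ‖h₀ - (ctr k g U).2‖ + ϱ * ‖w‖ ≤ RHist k)
    {emb : (tsys 4 N).Dom → D.carriers.Dom} (hscale : ∀ Z, D.carriers.scale (emb Z) = k)
    (terms : (tsys 4 N).Dom → Finset (D.carriers.Dom × J))
    {A₀ A₁ R r₁ : ℝ} (X₀ : (tsys 4 N).Dom) (hA₀ : 0 ≤ A₀) (hA₁ : 0 ≤ A₁) (hr₁ : 0 ≤ r₁)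
    (hrate : r₁ + 2 * (64 * Real.log 162) + 2 ≤ R)
    (hsmall : (A₀ + ϱ * A₁) * Real.exp (5 * r₁ + 1) * K₀ 64 8 * 9 * 64 ≤ 1)
    (hF3 : ∀ Z : (tsys 4 N).Dom, Z.1 ⊆ X₀.1 →
      ∑ p ∈ terms Z, factorMass (fun Z j => coreOf P Op 𝒵 dom Jc V (coreLettersOf D P Op 𝒵 dom Jc V mI A) Z j)
          (fun Z j => gaussC (mI Z j) * Real.sqrt (max 1 ((Fintype.card (mI Z j)).factorial * β₀ Z j ^ Fintype.card (mI Z j) +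
            γ Z j ^ Fintype.card (mI Z j))))
          (fun _ _ => 0) mstar (‖h₀‖ + ϱ * ‖w‖) p.1 p.2 ≤ (A₀ + ϱ * A₁) * Real.exp (-(R * torusTreeLen Z.1)))
    (hϱ : 2 ≤ ϱ) (hϱA : A₀ ≤ ϱ * A₁) :
    ‖locE (Dom := (tsys 4 N).Dom) (TTouch (d := 4) (N := N)) (fun Z : (tsys 4 N).Dom => Z.1) (fun Z => ∑ p ∈ terms Z,
          actOfLetters P Op 𝒵 dom Jc V (coreLettersOf D P Op 𝒵 dom Jc V mI A) p.1 p.2 o (h₀ + w)) X₀.1 -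
        locE (Dom := (tsys 4 N).Dom) (TTouch (d := 4) (N := N)) (fun Z : (tsys 4 N).Dom => Z.1) (fun Z => ∑ p ∈ terms Z,
          actOfLetters P Op 𝒵 dom Jc V (coreLettersOf D P Op 𝒵 dom Jc V mI A) p.1 p.2 o h₀) X₀.1‖ ≤
      4 * (Real.exp 1 * 9 * 64 * K₀ 64 8 ^ 2) * A₁ * Real.exp (-(r₁ * torusTreeLen X₀.1)) :=
  attachedPart_locE_le_of_coreLettersOf_factorMass_torus D P Op 𝒵 dom Jc V mI A (d₀ := fun Z j => γ Z j ^ Fintype.card (mI Z j))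
    hroom hR' hbase hrdm hβ₀ (fun Z j => pow_pos (coercivity_letter_pos D P Op 𝒵 dom Jc V mI A hR' hrd hmstar hfloor Z j) _) hrd
    (hctr_of_hermitian D P Op 𝒵 dom Jc V mI A
      (fun Z j => (coercivity_letter_pos D P Op 𝒵 dom Jc V mI A hR' hrd hmstar hfloor Z j).le) hent hherm hco)
    hbud hmstar hfloor hg hO hH hscale terms X₀ hA₀ hA₁ hr₁ hrate hsmall hF3 hϱ hϱA

/-! ## §4 LOCATED TIGHTNESS of S32's floor relettering — equality at `mq = m⋆` -/

section Floor

variable {C : Carriers} {P' : MeasPotFrame C} {Pol J' : Type*} {𝒴 : Pol → J' → Type*} {dom' : ∀ Z j, 𝒴 Z j → C.Dom} {Op' : Type*}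
  {PΛ : Pol → J' → Type*} {V' : Pol → J' → Type*} [∀ Z j, MeasurableSpace (PΛ Z j)] [∀ Z j, NormedAddCommGroup (V' Z j)]
  [∀ Z j, InnerProductSpace ℝ (V' Z j)] [∀ Z j, MeasurableSpace (V' Z j)]
  (𝔠 : ∀ Z j, BiCore P' (dom' Z j) Op' (PΛ Z j) (V' Z j))

/-- **S32 §1 IS AN EQUALITY AT THE FLOOR** (located arithmetic): at `mq = m⋆` the S30 letter summand
`λ(univ)·(wB·N₀·e^{0})·(π/(m⋆/2))^{dim/2}·e^{N₁R₀}` EQUALS row NE5's `factorMass 𝔠 N₀f 0 m⋆ R₀ Z j` (`π/(m⋆/2) = 2π/m⋆`) — the relettering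
of S32's `letterMass_le_factorMass` loses nothing at the floor (no sign or positivity hypothesis needed). [folklore] -/
theorem letterMass_eq_factorMass_at_floor {N₀f : Pol → J' → ℝ} {mstar R₀ : ℝ} (Z : Pol) (j : J') :
    (𝔠 Z j).lam.real univ * ((𝔠 Z j).wB * N₀f Z j * Real.exp 0) * (Real.pi / (mstar / 2)) ^ (Module.finrank ℝ (V' Z j) / 2 : ℝ) *
        Real.exp ((𝔠 Z j).N₁ * R₀) =
      factorMass 𝔠 N₀f (fun _ _ => 0) mstar R₀ Z j := by
  unfold factorMass
  rw [Real.exp_zero, mul_one, add_zero, div_div_eq_mul_div, mul_comm Real.pi 2]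
  ring

end Floor

end Summit.QuantumFields.BalabanUV.T4Continuum.NE1p.DressedSmallFieldOnCoresSlotLettersHermTorus

end
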